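import Summits.RiemannHypothesis.RiemannHypothesis.Theses.RuelleBand
import Literature.NumberTheory.LFunctions.DeBruijnHHeatFlow
import Literature.Analysis.Complex.Hurwitz

/-!
# `CofiniteCriticalLine` (crux stmt-RiemannHypothesis-2064): a kill forces the Ki–Kim–Lee thresholds to blow up

Companion of `KiKimLeeEndpoint.lean` (the crux is "Ki–Kim–Lee at `t = 0`": a threshold `T` beyond which, in
`|Re z|`, every zero of `H_0` is real). Ki–Kim–Lee (2009, Thm. 1.3) give such a threshold `T(t)` for every
`t > 0`. By Hurwitz's theorem (tree: `Complex.eventually_exists_zero_mem_ball_of_tendstoUniformlyOn`) and the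
joint continuity of `(t, z) ↦ H_t(z)` (tree: `continuous_cosMoment_uncurry`), every zero of `H_0` is a limit of
zeros of `H_t`, `t → 0⁺`; hence:

* `kiKimLee_at_zero_of_uniform` — if ONE threshold `T` works for all `t ∈ (0, δ)`, then `T + 1` works at
  `t = 0` (so the crux holds, by `cofiniteCriticalLine_iff_kiKimLee_at_zero`);
* `kiKimLee_thresholds_unbounded_of_not` — contrapositive, the disprover's reading: if the endpoint statement
  fails (¬ crux), then for every `T` and every `δ > 0` some `H_t`, `0 < t < δ`, has a NON-REAL zero with
  `|Re z| ≥ T`: the Ki–Kim–Lee thresholds `T(t)` are unbounded as `t → 0⁺`.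

Refuter's standing-adversary output (cdisprove cycle 1); statements about `H_t` only, no new definitions.
-/

noncomputable section

open Complex Set Filter Metric Topology

namespace Summit.RiemannHypothesis.Cruxes.CofiniteCriticalLine.Negative

open Literature.NumberTheory.LFunctions

/-- `(t, z) ↦ H_t(z)` is jointly continuous (tree: `continuous_cosMoment_uncurry 0`, `cosMoment_zero`).
[folklore] -/
theorem continuous_deBruijnH_uncurry : Continuous fun p : ℝ × ℂ => deBruijnH p.1 p.2 := by
  have h := continuous_cosMoment_uncurry 0
  simp_rw [cosMoment_zero] at h
  exact h

/-- `H_t → H_{t₀}` uniformly on closed balls as `t → t₀` (joint continuity on a compact set). [folklore] -/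
theorem tendstoUniformlyOn_deBruijnH (t₀ : ℝ) (z₀ : ℂ) (r : ℝ) :
    TendstoUniformlyOn (fun t : ℝ => deBruijnH t) (deBruijnH t₀) (𝓝 t₀) (closedBall z₀ r) := by
  rw [tendstoUniformlyOn_iff_tendstoUniformly_comp_coe]
  have hc : Continuous fun p : ℝ × (closedBall z₀ r) => deBruijnH p.1 (p.2 : ℂ) :=
    continuous_deBruijnH_uncurry.comp (continuous_fst.prodMk (continuous_subtype_val.comp continuous_snd))
  exact Continuous.tendstoUniformly (fun (t : ℝ) (w : closedBall z₀ r) => deBruijnH t (w : ℂ)) hc t₀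

/-- Zeros of `H_{t₀}` are isolated: `H_{t₀}` is entire (`differentiable_deBruijnH_holds`) and not identically
zero (`H_{t₀}(0) ≠ 0`, `deBruijnH_apply_zero_ne_zero`). [folklore] -/
theorem eventually_ne_zero_deBruijnH (t₀ : ℝ) (z₀ : ℂ) : ∀ᶠ z in 𝓝[≠] z₀, deBruijnH t₀ z ≠ 0 := by
  have hdiff : Differentiable ℂ (deBruijnH t₀) := differentiable_deBruijnH_holds t₀
  rcases (hdiff.analyticAt z₀).eventually_eq_zero_or_eventually_ne_zero with hev | hev
  · exfalso
    have hEq : EqOn (deBruijnH t₀) 0 univ :=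
      (hdiff.differentiableOn.analyticOnNhd isOpen_univ).eqOn_zero_of_preconnected_of_eventuallyEq_zero
        isPreconnected_univ (mem_univ z₀) hev
    exact deBruijnH_apply_zero_ne_zero t₀ (hEq (mem_univ 0))
  · exact hev

/-- HURWITZ STEP: a uniform Ki–Kim–Lee threshold on `(0, δ)` passes to the limit `t = 0`. If every zero `z`
of `H_t` with `|Re z| ≥ T` is real for all `0 < t < δ`, then every zero of `H_0` with `|Re z| ≥ T + 1` is
real. [folklore] -/
theorem kiKimLee_at_zero_of_uniform {T δ : ℝ} (hδ : 0 < δ)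
    (h : ∀ t : ℝ, 0 < t → t < δ → ∀ z : ℂ, deBruijnH t z = 0 → T ≤ |z.re| → z.im = 0) :
    ∀ z : ℂ, deBruijnH 0 z = 0 → T + 1 ≤ |z.re| → z.im = 0 := by
  intro z₀ hz₀ hre
  by_contra him
  have hdiff : ∀ t, Differentiable ℂ (deBruijnH t) := differentiable_deBruijnH_holds
  obtain ⟨r₁, hr₁, hball⟩ :=
    Metric.eventually_nhds_iff_ball.1 (eventually_nhdsWithin_iff.1 (eventually_ne_zero_deBruijnH 0 z₀))
  have him0 : 0 < |z₀.im| := abs_pos.2 him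
  set r : ℝ := min (r₁ / 2) (min (1 / 2) (|z₀.im| / 2)) with hr_def
  have hr : 0 < r := by
    simp only [hr_def, lt_min_iff]
    exact ⟨by linarith, by norm_num, by linarith⟩
  have hr₁' : r < r₁ := lt_of_le_of_lt (min_le_left _ _) (by linarith)
  have hrhalf : r ≤ 1 / 2 := le_trans (min_le_right _ _) (min_le_left _ _)
  have hrim : r ≤ |z₀.im| / 2 := le_trans (min_le_right _ _) (min_le_right _ _)
  have hunif : TendstoUniformlyOn (fun t : ℝ => deBruijnH t) (deBruijnH 0) (𝓝[>] (0 : ℝ))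
      (closedBall z₀ r) :=
    fun u hu => nhdsWithin_le_nhds ((tendstoUniformlyOn_deBruijnH 0 z₀ r) u hu)
  have hF : ∀ᶠ t in 𝓝[>] (0 : ℝ), DiffContOnCl ℂ (deBruijnH t) (ball z₀ r) :=
    Filter.Eventually.of_forall fun t => (hdiff t).diffContOnCl
  have hsphere : ∀ z ∈ sphere z₀ r, deBruijnH 0 z ≠ 0 := by
    intro z hz
    refine hball z (sphere_subset_closedBall.trans (closedBall_subset_ball hr₁') hz) ?_
    rw [mem_compl_singleton_iff]
    intro hzz
    have : dist z z₀ = r := mem_sphere.1 hz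
    rw [hzz, dist_self] at this
    exact hr.ne this
  have hcont : ContinuousOn (deBruijnH 0) (sphere z₀ r) := (hdiff 0).continuous.continuousOn
  have hev2 := Complex.eventually_exists_zero_mem_ball_of_tendstoUniformlyOn hr hF hunif hcont hz₀ hsphere
  have hev3 : ∀ᶠ t in 𝓝[>] (0 : ℝ), t ∈ Ioo 0 δ := Ioo_mem_nhdsGT hδ
  obtain ⟨t, ⟨ht0, htδ⟩, zt, hzt, hzt0⟩ := (hev3.and hev2).exists
  have hd : ‖zt - z₀‖ < r := by rwa [mem_ball, dist_eq_norm] at hzt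
  have hre_t : T ≤ |zt.re| := by
    have h1 : |zt.re - z₀.re| < r := lt_of_le_of_lt (by simpa using abs_re_le_norm (zt - z₀)) hd
    have h2 := abs_sub_abs_le_abs_sub z₀.re zt.re
    rw [abs_sub_comm] at h2
    linarith
  have him_t := h t ht0 htδ zt hzt0 hre_t
  have h3 : |zt.im - z₀.im| < r := lt_of_le_of_lt (by simpa using abs_im_le_norm (zt - z₀)) hd
  rw [him_t, zero_sub, abs_neg] at h3
  linarith

/-- THE DISPROVER'S READING: if the endpoint statement fails (no threshold at `t = 0`, i.e. `¬ CofiniteCriticalLine`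
by `cofiniteCriticalLine_iff_kiKimLee_at_zero`), then the Ki–Kim–Lee thresholds are unbounded as `t → 0⁺`:
for every `T` and `δ > 0` some `H_t`, `0 < t < δ`, has a non-real zero `z` with `|Re z| ≥ T`. [folklore] -/
theorem kiKimLee_thresholds_unbounded_of_not
    (hno : ¬ ∃ T : ℝ, ∀ z : ℂ, deBruijnH 0 z = 0 → T ≤ |z.re| → z.im = 0) (T δ : ℝ) (hδ : 0 < δ) :
    ∃ t : ℝ, 0 < t ∧ t < δ ∧ ∃ z : ℂ, deBruijnH t z = 0 ∧ T ≤ |z.re| ∧ z.im ≠ 0 := by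
  by_contra hcon
  apply hno
  refine ⟨T + 1, kiKimLee_at_zero_of_uniform hδ fun t ht0 htδ z hz hT => ?_⟩
  by_contra him
  exact hcon ⟨t, ht0, htδ, z, hz, hT, him⟩

end Summit.RiemannHypothesis.Cruxes.CofiniteCriticalLine.Negative

end
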